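import Literature.MathematicalPhysics.QuantumFieldTheory.Balaban1983to89.B9LettersHCOneObstruction
import Literature.MathematicalPhysics.QuantumFieldTheory.Balaban1983to89.B9CoReadingCoordsInput
import Literature.MathematicalPhysics.QuantumFieldTheory.Balaban1983to89.B9Thm313WholeDirInputB

/-!
# `Balaban1983to89.B9Letters313IMBLocObstruction` — LOCATED «INPUT-LOC-CLASS-VS-FIBRE»: the N06 certificate's rows-20–21 binder `hLIM`
# (`B9Thm313WholeDirInputB.Letters313IMB` at the pins `hbHXA` = n06-k's input norm `bHK`, `hblk12` = `blkBK bI`) is UNSATISFIABLE AS TYPED — its field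
# `locX` transfers localisation from CARRIER CLASSES to `bI`-FIBRES, and a carrier class holds two index bonds

T. Bałaban, *Propagators for lattice gauge theories in a background field*, Commun. Math. Phys. **99** (1985) 389–434
[`Balaban1985BackgroundPropagators`, "B9"]; [4] = T. Bałaban, *Propagators and renormalization transformations for lattice gauge
theories. II*, Commun. Math. Phys. **96** (1984) 223–250 [`Balaban1984PropagatorsII`].

statement-level skeleton of published theorems with citation tags; proofs where landed; nothing here is a claim about the Yang–Mills mass gap

THE PRINTED LOCI (verbatim).  [B9] (3.39)–(3.41) p. 397 (the norms `|λ|`, `‖λ‖_ε` on `supp λ ⊂ Δ(y′)`), (3.44) p. 398: *"… (‖λ‖_ε + |λ|) for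
λ ∈ C^ε₀(Δ̃(y′))"*; [4] (2.3) p. 224: *"Λ_j also denotes the set of bonds with at least one end-point in Λ_j"*, (2.45) p. 231 (`𝔅 = ⋃_j Λ_j`, the blocks
`Δ(y)`), (2.51)–(2.52) p. 232 (block majorants, `supp λ ⊂ Δ(y′)`).  In print a block `Δ(y)` is labelled by ONE `y`; in the tree the index set of the
N06 geometry `geo9K` is the set of INDEX BONDS `c = ⟨j, b⟩`, up to `2(d+1)` of which share one carrier block `β c` (n06-l `B9CarrierBlockMultiplicity`).

THE POINT.  The certificate of record (dag-n06-d, editions 19–22, `Summits/…/BalabanUVNodesN06AtOpsYNuOfRecordV6EPairMZ … NC`) displays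
`hLIM : ∀ x, M12 ≤ M → ∀ α₀ > 0, Mα₀ ≤ a12 → ∀ U ∈ (3.35) ∩ (3.36), Letters313IMB (𝔬12 x) (𝔭A x) (𝔡A x).Dd (𝔡A x).Dsd 1 (H x) _ (bHXA x) (bHW13 x) …`
(dag-n06-l's schema of the row-21 input letters) with the pins `hbHXA : bHXA x = fun ε => bHK x.toKIdx (bI x) ε` (dag-n06-k's (3.44) input block norm:
`IsLoc y F :↔ F vanishes off the carrier CLASS of y`, i.e. off `{p | β (bI p.1) = β y}` — `B9CoReadingCoordsInput`, "so that `Σ_y cut y = id` although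
classes may carry several index bonds") and `hblk12 : (𝔬12 x).blk = blkBK x.toKIdx (bI x)` (so `BlockNorm.ofBlocks … 𝔬.blk` has `IsLoc y F :↔ F vanishes
off the FIBRE {p | bI p.1 = y}`).  The schema's field
`locX : ∀ ε > 0, ∀ y μ, (bHX ε).IsLoc y μ → (BlockNorm.ofBlocks (toB6 g R₀ H₀) 𝔬.blk).IsLoc y μ` (consumed by `B9Thm313WholeInput.hasMaj_of_dom` to move
sharp-block majorants onto the input class) therefore asks: «vanishing off the class of `y` ⟹ vanishing off the fibre of `y`» — FALSE as soon as the class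
of `y` contains a second index bond `y′ ≠ y` whose `bI`-fibre is non-empty (the indicator of a point of that fibre is a witness), and for the certificate's
CARRIER-FAITHFUL `bI` (`hβI`) every class meets the image of `bI`.  THIS FILE proves it in the kernel:
* §1 `exists_two_sameCarrier`: at a top-empty index (`lev ≤ k − 1`, a site of level `k − 1`, `d + 1 ≥ 2`) the bonds `⟨y₀, y₀+e₀⟩ ≠ ⟨y₀, y₀+e₁⟩` one level
  below the top are index bonds with the same carrier block;
* §2 ★★ `not_isLoc_bHK_imp_ofBlocks`: for a carrier-faithful `bI`, a two-member class and any `ε, R₀, H₀`: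
  `¬ ∀ y μ, (bHK bI ε).IsLoc y μ → (ofBlocks (blkBK bI)).IsLoc y μ`;
* §3 `exists_member_two_sameCarrier`: beyond every threshold `M₁` a member (`MemberY.diag` over `Node00.kRIdx_nonvacuous_oddL`, odd `L ≥ 5`) with such a class;
* §4 ★★★ `hLIM_pins_false`: NO numerics make the displayed `∀x`-binder true — all other letters of `Letters313IMB` (`𝔭 Dd Dds bHW`) and all its constants
  (`Br θv Bd Bd2 δ₃ δK`, even member- and `α₀`-dependent) ARBITRARY; tested at `U = 1` (`reg335Y_one ∕ reg336Y_one`), `α₀ = a12∕M`, field `locX`, `ε = 1`.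
CONSEQUENCE (A6, rows 20–21 JSAT): editions 19–22 are VACUOUS AS TYPED in `hLIM` (independently of `U`, of every estimate, and of the C-letter repair R1-cls);
the companion field `domX` (`(ofBlocks blk).loc ≤ (bHK ε).loc`) is fine — class-sup ≥ fibre-sup.  THE DEFECT IS A DIRECTION, NOT AN ESTIMATE.  Repair
candidates (owners: dag-n06-l schema ∕ `B9Thm313WholeDirInput*` cores, dag-n06-k input norm, dag-n06-d knit), both count-neutral:
(R-a) («R2-loc», dag-n06-d's word, pub-ymgap bus 2026-08-28 l.26255) drop `locX` and let the consumer pay the class multiplicity `m ≤ 2(d+1)`: a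
class-localised input is the sum of its `≤ m` fibre pieces, each dominated through `domX`, and the kernels of record depend on carrier blocks only
(`B9CoRealizesRelAtLetters.maj342_relB_left ∕ right`, `dist_eq_of_relB`) — `HasMaj (ofBlocks blk) b₂ T K → HasMaj (bHX ε) b₂ T (m·K)`, the device of
n06-l's `B9CoRealizesRel`; (R-b) a FIBRE-localised twin of `bHK` would make `locX` trivial but is NOT available: n06-k's (3.44) input co-reading
`InputReadsFam.isLoc` must accept print's `λ ⊂ Δ̃(y′)`, whose evaluation lives on the whole carrier class (dag-n06-d, same line) — so the schema field and
the input co-reading are inconsistent at ANY pin of `bHX`, and the repair is schema ∕ engine-side (R-a).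

HONEST SCOPE.  Lattice combinatorics of the tree's own objects (n06-k's `bHK`, n06-d's `blkBK`, NODE 00's index bonds) — nothing of [B9] or [4] is
asserted or denied; the located statement is a TYPING defect of one schema field at the pins, with a witness; COUNT-NEUTRAL; N06 NOT discharged (nor
refuted: the node's printed content is untouched); one finite lattice at a time; nothing continuum, nothing about the mass gap.  Cell `pub-ymgap`
(HUMAN RULING D-0062 ∕ D-0149), Track A node N06 [B9], rows 20–21 joint-satisfiability lane, width seat `pub-ymgap-dag-n06-w3` (g2), 2026-08-28.
-/

noncomputable section

namespace Literature.MathematicalPhysics.QuantumFieldTheory.Balaban1983to89.B9Letters313IMBLocObstruction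

open B6MultiLevelBoxOperator (N0) open B4Reflection242 (boxDom) open B6MultiLevelTorusOperator (TDomains) open B6Geom246MultiLevelTorus (geomT)
open B6GlobalChartV1 (PV blkV1 boxEquiv boxEquiv_apply toBox domT iterBlockOf_mem_domT_iff) open B6Geom246MultiLevelBox (bset blkOf)
open B6KLevelCensusIndexV1 (KIdx kGeo kGeoG) open B6SectAOperatorsV1 (BondIdx) open B5Eq118OneStroke (iterBlockOf)
open B6Ineq2142KLevelV1 (lvl β base baseSite iterBlockOf_baseSite lev_eq_of_base) open B6ScalarChartV1 (blkOf_toBox_eq_iff)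
open B9Eq3132FlatReadingAtOne (not_deep_of_lev_le) open B9GeoNormsKLevelV1 (geo9K) open B9Thm34Ext (toB6) open B11SectG (BlockNorm HasMaj)
open B9CoRealizesRelAtLetters (RelB relB_refl) open B9CoReadingCoords (XBK blkBK) open B9CoReadingCoordsInput (bHK)
open B9PinMembersKLevelV1 (MemberY geo9Y bg9Y reg335Y_one reg336Y_one) open B9Thm312Whole (Ops) open B9RWSums343Holder (HolderProbes)
open B9Thm313WholeDirInputB (Letters313IMB) open Node00

variable {d ℓ : ℕ} {hd : 1 ≤ d + 1} {hL : Odd (ℓ + 1) ∧ 1 < ℓ + 1} {b₀ b₁ : ℝ}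

/-! ## §1 At a top-empty index, two DISTINCT index bonds with the SAME carrier block (two directions out of one base point) -/

section TwoBonds

variable (i : KIdx d ℓ hd hL b₀ b₁)

/-- **TWO INDEX BONDS OF ONE CARRIER CLASS**: if the nominal top level is empty (`lev ≤ k − 1`) and `x₀` is a fine site of level `k − 1`, then for `d + 1 ≥ 2`
the bonds `⟨y₀, y₀ + e₀⟩`, `⟨y₀, y₀ + e₁⟩` of the `(k−1)`-lattice, `y₀ = y^{k−1}(x₀)`, are distinct index bonds (nothing is deep one level below an empty
top) based at the same point, hence with the same carrier block `β` — a carrier class with two members.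
[cite: Balaban1984PropagatorsII, (2.3) p.224 («Λ_j also denotes the set of bonds with at least one end-point in Λ_j»), (2.45) p.231] -/
theorem exists_two_sameCarrier (hd1 : 1 ≤ d) (htop : ∀ z, i.D.lev z ≤ i.k - 1) (x₀ : Site (PV d ℓ i.m i.K hd hL) 0)
    (hx₀ : i.D.lev (toBox i.hN x₀ : Fin (d + 1) → ℤ) = i.k - 1) :
    ∃ c₀ c₁ : IBondY i, c₀ ≠ c₁ ∧ RelB i c₀ c₁ := by
  have hk2 := i.hk2
  have hjlt : i.k - 1 < (domT i.hN i.D i.hk).k + 1 := by show i.k - 1 < i.k + 1; omega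
  have hy : iterBlockOf (i.k - 1) x₀ ∈ (domT i.hN i.D i.hk).Om (i.k - 1) :=
    (iterBlockOf_mem_domT_iff i.hN i.D i.hk (by omega) (by omega) x₀).2 hx₀.ge
  have hnd : ∀ z : Site (PV d ℓ i.m i.K hd hL) (i.k - 1), ¬ (domT i.hN i.D i.hk).Deep (i.k - 1) z :=
    not_deep_of_lev_le i.hN i.D i.hk (by omega) htop
  let mk : Fin (d + 1) → IBondY i := fun μ =>
    ⟨⟨⟨i.k - 1, hjlt⟩, ⟨iterBlockOf (i.k - 1) x₀, μ⟩⟩, ⟨Or.inl hy, hnd _, hnd _⟩⟩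
  have hbase : ∀ μ, base i.hN i.D i.hk (mk μ) = iterBlockOf (i.k - 1) x₀ := fun μ => by
    show (if (iterBlockOf (i.k - 1) x₀) ∈ (domT i.hN i.D i.hk).Om (i.k - 1) then iterBlockOf (i.k - 1) x₀
      else (⟨iterBlockOf (i.k - 1) x₀, μ⟩ : PBond (PV d ℓ i.m i.K hd hL) (i.k - 1)).tgt) = _
    rw [if_pos hy]
  have hlev : ∀ μ, i.D.lev (toBox i.hN (baseSite i.hN i.D i.hk (mk μ)) : Fin (d + 1) → ℤ) = i.k - 1 := fun μ =>
    lev_eq_of_base i.hN i.D i.hk (by omega) (mk μ) (iterBlockOf_baseSite i.hN i.D i.hk (mk μ))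
  have hbs : ∀ μ, iterBlockOf (i.k - 1) (baseSite i.hN i.D i.hk (mk μ)) = iterBlockOf (i.k - 1) x₀ := fun μ =>
    (iterBlockOf_baseSite i.hN i.D i.hk (mk μ)).trans (hbase μ)
  refine ⟨mk 0, mk ⟨1, by omega⟩, fun h => ?_, ?_⟩
  · have h' := congrArg (fun c : IBondY i => (c.1.2.dir : ℕ)) h
    simp [mk] at h'
  · show blkOf i.D.toDomains (toBox i.hN (baseSite i.hN i.D i.hk (mk 0))) = blkOf i.D.toDomains (toBox i.hN (baseSite i.hN i.D i.hk (mk ⟨1, _⟩)))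
    rw [blkOf_toBox_eq_iff i.hN i.D i.hk (baseSite i.hN i.D i.hk (mk ⟨1, by omega⟩)) (baseSite i.hN i.D i.hk (mk 0)), hlev, hbs, hbs]

end TwoBonds

/-! ## §2 THE OBSTRUCTION: class-localisation does not imply fibre-localisation once a carrier class has two index bonds -/

section Obstruction

variable {κ : Type} [Fintype κ] [DecidableEq κ]
variable (i : KIdx d ℓ hd hL b₀ b₁) [Fintype (geo9K i).Site] [DecidableRel (RelB i)]

/-- ★★ **`IsLoc` DOES NOT TRANSFER FROM n06-k's INPUT NORM `bHK` TO THE SHARP-BLOCK SUP NORM ON `blkBK bI`**: `(bHK bI ε).IsLoc y F` says `F` vanishes off the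
CARRIER CLASS of `y` (`RelB (bI p.1) y`), `(ofBlocks (blkBK bI)).IsLoc y F` says `F` vanishes off the `bI`-FIBRE of `y` (`bI p.1 = y`); for a
carrier-faithful `bI` (the certificate's `hβI`) and a class `{c₀, c₁, …}` with two members, the indicator of one carrier point in the fibre of a class member
`y′` is class-localised at the OTHER member `y ≠ y′` but not fibre-localised there.  So the implication `∀ y μ, IsLoc_bHK → IsLoc_ofBlocks` is FALSE.
[cite: Balaban1985BackgroundPropagators, (3.39)–(3.41) p.397, (3.44) p.398; Balaban1984PropagatorsII, (2.45) p.231, (2.51)–(2.52) p.232] -/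
theorem not_isLoc_bHK_imp_ofBlocks (s : κ) {bI : FBondY i → IBondY i}
    (hβI : ∀ (f : FBondY i) (c : IBondY i), blkV1 i.hN i.D f = β i.hN i.D i.hk c → β i.hN i.D i.hk (bI f) = blkV1 i.hN i.D f)
    {c₀ c₁ : IBondY i} (hne : c₀ ≠ c₁) (hrel : RelB i c₀ c₁) (ε : ℝ) {R₀ : ℝ} {H₀ : Prop} :
    ¬ ∀ (y : IBondY i) (μ : XBK κ i → ℝ), (bHK (R := R₀) (H := H₀) i bI ε).IsLoc y μ →
        (BlockNorm.ofBlocks (toB6 (geo9K i) R₀ H₀) (blkBK (κ := κ) i bI)).IsLoc y μ := by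
  classical
  intro H
  -- a fine bond in the carrier block of `c₀`; its image under `bI` lies in the class of `c₀`
  let f : FBondY i := ⟨baseSite i.hN i.D i.hk c₀, 0⟩
  have hf : blkV1 i.hN i.D f = β i.hN i.D i.hk c₀ := rfl
  have hy' : RelB i (bI f) c₀ := (hβI f c₀ hf).trans hf
  -- a class member `y ≠ bI f`
  obtain ⟨y, hyrel, hyne⟩ : ∃ y : IBondY i, RelB i (bI f) y ∧ bI f ≠ y := by
    by_cases h : bI f = c₀
    · exact ⟨c₁, h ▸ hrel, h ▸ hne⟩
    · exact ⟨c₀, hy', h⟩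
  -- the indicator of the carrier point `p₀ = (f, 0, s, s)`
  let p₀ : XBK κ i := (f, 0, s, s)
  have hloc : (bHK (R := R₀) (H := H₀) i bI ε).IsLoc y (fun p => if p = p₀ then (1 : ℝ) else 0) := by
    show ∀ p : XBK κ i, ¬ RelB i (bI p.1) y → (if p = p₀ then (1 : ℝ) else 0) = 0
    intro p hp
    by_cases hpp : p = p₀
    · exact absurd (by rw [hpp]; exact hyrel) hp
    · rw [if_neg hpp]
  have h0 := H y _ hloc
  have h1 : (if p₀ = p₀ then (1 : ℝ) else 0) = 0 := by
    have h2 : ∀ p : XBK κ i, blkBK (κ := κ) i bI p ≠ y → (if p = p₀ then (1 : ℝ) else 0) = 0 := h0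
    exact h2 p₀ hyne
  simp at h1

end Obstruction

/-! ## §3 Members beyond every threshold carry a two-member carrier class (the top-empty members of `Node00.kRIdx_nonvacuous_oddL`) -/

section Members

variable {Mstar : ℕ}

/-- **BEYOND EVERY THRESHOLD `M₁` THERE IS A MEMBER WITH A CARRIER CLASS OF TWO INDEX BONDS** (odd `L ≥ 5`, `d + 1 ≥ 2`): the diagonal member
(`MemberY.diag`) over NODE 00's top-empty index of nominal `k = 2` with `M ≥ M₁` (`Node00.kRIdx_nonvacuous_oddL`), at whose level-`1` site §1 applies.
[cite: Balaban1984PropagatorsII, (2.1)–(2.4) p.224 («We admit the case when some domains Ω_j are equal to T_η»), (2.45) p.231] -/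
theorem exists_member_two_sameCarrier (hℓ : 4 ≤ ℓ) (hd1 : 1 ≤ d) (hb₀ : 0 < b₀) (hb₁ : b₀ ≤ b₁) (M₁ : ℝ) :
    ∃ x : MemberY d ℓ hd hL b₀ b₁ Mstar, M₁ ≤ (geo9Y x).M ∧ ∃ c₀ c₁ : IBondY x.toKIdx, c₀ ≠ c₁ ∧ RelB x.toKIdx c₀ c₁ := by
  obtain ⟨i, hik, hM, -, htop, ⟨z, hz, hlev⟩, -⟩ :=
    Node00.kRIdx_nonvacuous_oddL d ℓ 2 hd hL hℓ le_rfl (max M₁ (Mstar : ℝ)) 0 hb₀ hb₁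
  have hMi : (kGeoU i.1).M = ((ℓ + 1 : ℕ) : ℝ) * (i.1.Mh : ℝ) := rfl
  have hMstar : Mstar ≤ (ℓ + 1) * i.1.Mh := by
    have h : (Mstar : ℝ) ≤ ((ℓ + 1 : ℕ) : ℝ) * (i.1.Mh : ℝ) := hMi ▸ le_trans (le_max_right _ _) hM
    exact_mod_cast h
  refine ⟨MemberY.diag i.1 i.2 hMstar, ?_, ?_⟩
  · show M₁ ≤ (kGeoU i.1).M
    exact le_trans (le_max_left _ _) hM
  · set x₀ : Site (PV d ℓ i.1.m i.1.K hd hL) 0 := (boxEquiv i.1.hN).symm ⟨z, hz⟩ with hx₀def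
    have hx₀ : (toBox i.1.hN x₀ : Fin (d + 1) → ℤ) = z := by
      have := (boxEquiv i.1.hN).apply_symm_apply ⟨z, hz⟩
      rw [boxEquiv_apply] at this
      exact congrArg Subtype.val this
    have htop' : ∀ w, i.1.D.lev w ≤ i.1.k - 1 := fun w => by have := htop w; omega
    exact exists_two_sameCarrier i.1 hd1 htop' x₀ (by rw [hx₀]; omega)

end Members

/-! ## §4 Hence the displayed binder `hLIM` of the N06 certificate (editions 19–22: `Letters313IMB` with the pins `hbHXA`, `hblk12`) is FALSE for every value
of its numerics and of its other letters -/

section Certificate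

variable {𝔸 : Type} [NormedRing 𝔸] [NormedAlgebra ℂ 𝔸] [CompleteSpace 𝔸] [NormOneClass 𝔸]
variable {κ : Type} [Fintype κ] [DecidableEq κ] {Mstar : ℕ}

/-- ★★★ **THE N06 CERTIFICATE's ROWS-20–21 BINDER `hLIM` IS UNSATISFIABLE AT THE PINS `hbHXA` × `hblk12`**: for letter records `𝔬 x` over the members'
geometries with `blk = blkBK (bI x)` (the certificate's `hblk12`), the input block norm family `bHX x = bHK (bI x)` (its `hbHXA`) and `bI x` carrier-faithful
(its `hβI`) — all other letters (`𝔭`, `Dd`, `Dds`, `bHW`) and all numerics (`Br θv Bd Bd2 δ₃ δK`, even depending on the member and on `α₀`) ARBITRARY — NO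
`M12, a12 > 0` make `∀ x, M12 ≤ M → ∀ α₀ > 0, Mα₀ ≤ a12 → ∀ U ∈ (3.35) ∩ (3.36), Letters313IMB (𝔬 x) … U` true: test it at a member of §3 (odd `L ≥ 5`,
`d ≥ 1`), `U = 1` (`reg335Y_one ∕ reg336Y_one`), `α₀ = a12∕M`, and read off the field `locX` (§2).  So editions 19–22 are VACUOUS AS TYPED in this binder;
the located defect is the DIRECTION of `locX` (class-localised input norm vs fibre-localised `ofBlocks 𝔬.blk`), not an estimate — repair candidates in
the module docstring. [cite: Balaban1985BackgroundPropagators, (3.39)–(3.41) p.397, (3.44) p.398, (3.35)–(3.36) p.396, Thm 3.13 p.426; Balaban1984PropagatorsII, (2.3) p.224, (2.45) p.231, (2.51)–(2.52) p.232] -/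
theorem hLIM_pins_false (hℓ : 4 ≤ ℓ) (hd1 : 1 ≤ d) (hb₀ : 0 < b₀) (hb₁ : b₀ ≤ b₁) (G : Subgroup 𝔸ˣ) (s : κ)
    [∀ x : MemberY d ℓ hd hL b₀ b₁ Mstar, Fintype (geo9Y x).Site] [∀ x : MemberY d ℓ hd hL b₀ b₁ Mstar, DecidableRel (RelB x.toKIdx)]
    {Yc Zc Wc PXc PYc Pc : MemberY d ℓ hd hL b₀ b₁ Mstar → Type}
    [∀ x, Fintype (Yc x)] [∀ x, Fintype (Zc x)] [∀ x, Fintype (Wc x)] [∀ x, Fintype (PXc x)] [∀ x, Fintype (PYc x)] [∀ x, Fintype (Pc x)]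
    (𝔬 : ∀ x : MemberY d ℓ hd hL b₀ b₁ Mstar, Ops (geo9Y x) (bg9Y 𝔸 G x) (XBK κ x.toKIdx) (Yc x) (Zc x) (Wc x))
    (bI : ∀ x : MemberY d ℓ hd hL b₀ b₁ Mstar, FBondY x.toKIdx → IBondY x.toKIdx)
    (hβI : ∀ (x : MemberY d ℓ hd hL b₀ b₁ Mstar) (f : FBondY x.toKIdx) (c : IBondY x.toKIdx),
      blkV1 x.hN x.D f = β x.hN x.D x.hk c → β x.hN x.D x.hk (bI x f) = blkV1 x.hN x.D f)
    (hblk : ∀ x, (𝔬 x).blk = blkBK (κ := κ) x.toKIdx (bI x))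
    (R₀ : MemberY d ℓ hd hL b₀ b₁ Mstar → ℝ) (H₀ : MemberY d ℓ hd hL b₀ b₁ Mstar → Prop)
    (hlen : ∀ x : MemberY d ℓ hd hL b₀ b₁ Mstar, ∀ y : (geo9Y x).Site, 0 ≤ (geo9Y x).len y)
    (bHX : ∀ x : MemberY d ℓ hd hL b₀ b₁ Mstar, ℝ → BlockNorm (toB6 (geo9Y x) (R₀ x) (H₀ x)) (XBK κ x.toKIdx → ℝ))
    (hbHX : ∀ x, bHX x = fun ε =>
      letI : Fintype (B9GeoNormsKLevelV1.geo9K x.toKIdx).Site := (inferInstance : Fintype (geo9Y x).Site); bHK x.toKIdx (bI x) ε)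
    (𝔭 : ∀ x : MemberY d ℓ hd hL b₀ b₁ Mstar, HolderProbes (geo9Y x) (bg9Y 𝔸 G x) (XBK κ x.toKIdx) (Yc x) (PXc x) (PYc x))
    (Dd Dds : ∀ x : MemberY d ℓ hd hL b₀ b₁ Mstar, (bg9Y 𝔸 G x).Cfg → Pc x → Module.End ℝ (XBK κ x.toKIdx → ℝ))
    (bHW : ∀ x : MemberY d ℓ hd hL b₀ b₁ Mstar, ℝ → ℝ → BlockNorm (toB6 (geo9Y x) (R₀ x) (H₀ x)) (Wc x → ℝ))
    (Br θv Bd : MemberY d ℓ hd hL b₀ b₁ Mstar → ℝ → ℝ → ℝ) (Bd2 : MemberY d ℓ hd hL b₀ b₁ Mstar → ℝ → ℝ → ℝ → ℝ)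
    (δ₃ δK : MemberY d ℓ hd hL b₀ b₁ Mstar → ℝ → ℝ)
    {c35 M12 a12 : ℝ} (hc35 : 0 < c35) (ha12 : 0 < a12) :
    ¬ ∀ x : MemberY d ℓ hd hL b₀ b₁ Mstar, M12 ≤ (geo9Y x).M → ∀ α₀ : ℝ, 0 < α₀ → (geo9Y x).M * α₀ ≤ a12 →
        ∀ U : (bg9Y 𝔸 G x).Cfg, (bg9Y 𝔸 G x).Reg335 c35 α₀ U → (bg9Y 𝔸 G x).Reg336 c35 α₀ U →
          Letters313IMB (𝔬 x) (𝔭 x) (Dd x) (Dds x) (R₀ x) (H₀ x) (hlen x) (bHX x) (bHW x α₀) (Br x α₀) (θv x α₀) (Bd x α₀) (Bd2 x α₀)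
            (δ₃ x α₀) (δK x α₀) U := by
  intro H
  obtain ⟨x, hM, c₀, c₁, hne, hrel⟩ := exists_member_two_sameCarrier (Mstar := Mstar) hℓ hd1 hb₀ hb₁ (max M12 1)
  have hM12 : M12 ≤ (geo9Y x).M := (le_max_left _ _).trans hM
  have hMpos : 0 < (geo9Y x).M := lt_of_lt_of_le one_pos ((le_max_right _ _).trans hM)
  set α₀ : ℝ := a12 / (geo9Y x).M with hα₀
  have hα : 0 < α₀ := div_pos ha12 hMpos
  have hMα : (geo9Y x).M * α₀ ≤ a12 := by rw [hα₀, mul_div_cancel₀ _ hMpos.ne']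
  have hL := (H x hM12 α₀ hα hMα _ (reg335Y_one (𝔸 := 𝔸) (G := G) x hc35 hα) (reg336Y_one (𝔸 := 𝔸) (G := G) x hc35 hα)).locX 1 one_pos
  rw [hbHX x, hblk x] at hL
  letI : Fintype (B9GeoNormsKLevelV1.geo9K x.toKIdx).Site := (inferInstance : Fintype (geo9Y x).Site)
  exact not_isLoc_bHK_imp_ofBlocks x.toKIdx s (hβI x) hne hrel 1 hL

end Certificate

end Literature.MathematicalPhysics.QuantumFieldTheory.Balaban1983to89.B9Letters313IMBLocObstruction

end
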